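import Mathlib
import Summits.MatrixMultiplication.MatrixMultiplication.Theses.HessianPlane

/-!
# `HessianPlane.UnitPoints` — the twelve unit points of the Hessian plane have rank ≤ 3

Route `MatrixMultiplication/HessianPlane`, item `stmt-MatrixMultiplication-4899` (support):
for the translation-invariantly weighted `ℤ/3` addition table
`u(a,b,c)(x,y,z) = [x+y+z ≡ 0]·w(y−x)`, `w = (a,b,c)` (Nurmiev's semisimple normal form
`a·X₁ + b·X₂ + c·X₃` of `3×3×3` tensors; Bremner–Hu–Oeding 2014 §4, Nurmiev 2000),
`R(u(a,b,c)) ≤ 3` whenever two of the three weights vanish (a coordinate point: `u` is a single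
`X_i`, a relabelled unit tensor `⟨3⟩`) or `a³ = b³ = c³` (the nine torus points: `u(1,1,1) =
[x+y+z ≡ 0] = ⅓ Σ_χ χ⊗χ⊗χ` over the three characters `χ` of `ℤ/3`, and `u(a,b,c)` with
`a³ = b³ = c³ ≠ 0` is its image under the diagonal torus element
`(diag(1,1,c²/(ab)), diag(a,ab/c,b), diag(1,c/b,c/a))`; for `a = 0` the tensor vanishes).

Proof structure:
* `unitPoints_tensorRank_pattern_le` — a "permutation pattern" tensor
  `(x,y,z) ↦ [y = σ x ∧ z = τ x]·t x` is the sum of the three triads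
  `t_i e_i ⊗ e_{σ i} ⊗ e_{τ i}`;
* `unitPoints_tensorRank_supportMul_le` — `(x,y,z) ↦ [x+y+z ≡ 0]·f(x)g(y)h(z)` is the sum of the
  three triads `⅓(f·χ_k) ⊗ (g·χ_k) ⊗ (h·χ_k)`, `χ_k(s) = ω^{ks}`, `ω = exp(2πi/3)`;
* the four cases of the item are instances after an entrywise (`fin_cases`) identification.
-/

-- `Summit.<Summit>.<Problem>` is the tree's mandated summit-side namespace; for this
-- single-conjunct summit the two coincide, so the file silences `dupNamespace`.
set_option linter.dupNamespace false

namespace Summit.MatrixMultiplication.MatrixMultiplication.Theorems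

open Literature.Computability.AlgebraicComplexity
open scoped BigOperators

/-- A permutation-pattern tensor `(x,y,z) ↦ [y = σ x ∧ z = τ x]·t x` on `Fin 3` has rank at most
`3`: it is the sum of the three triads `(t i·e_i) ⊗ e_{σ i} ⊗ e_{τ i}`. -/
theorem unitPoints_tensorRank_pattern_le (t : Fin 3 → ℂ) (σ τ : Fin 3 → Fin 3) :
    tensorRank (fun x y z : Fin 3 => if y = σ x ∧ z = τ x then t x else 0) ≤ 3 := by
  classical
  have h := tensorRank_le_card_of_eq_sum
    (t := fun x y z : Fin 3 => if y = σ x ∧ z = τ x then t x else 0)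
    (fun i : Fin 3 => Pi.single i (t i)) (fun i => Pi.single (σ i) (1 : ℂ))
    (fun i => Pi.single (τ i) (1 : ℂ)) ?_
  · simpa using h
  · funext x y z
    rw [Finset.sum_apply, Finset.sum_apply, Finset.sum_apply]
    simp only [triad_apply]
    rw [Fintype.sum_eq_single x]
    · by_cases hy : y = σ x <;> by_cases hz : z = τ x <;> simp [hy, hz]
    · intro i hi
      simp [Pi.single_apply, Ne.symm hi]

/-- A tensor supported on the `ℤ/3` addition table and multiplicatively weighted there,
`(x,y,z) ↦ [x+y+z ≡ 0]·f(x)g(y)h(z)`, has rank at most `3`: with `ω = exp(2πi/3)` and the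
characters `χ_k(s) = ω^{ks}` of `ℤ/3`, `[x+y+z ≡ 0] = ⅓ Σ_k χ_k(x)χ_k(y)χ_k(z)`, so the tensor is
`Σ_k ⅓(f·χ_k) ⊗ (g·χ_k) ⊗ (h·χ_k)`. -/
theorem unitPoints_tensorRank_supportMul_le (f g h : Fin 3 → ℂ) :
    tensorRank (fun x y z : Fin 3 => if x + y + z = 0 then f x * g y * h z else 0) ≤ 3 := by
  obtain ⟨ω, hω, h3⟩ : ∃ ω : ℂ, 1 + ω + ω ^ 2 = 0 ∧ ω ^ 3 = 1 := by
    have hprim := Complex.isPrimitiveRoot_exp 3 (by norm_num)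
    refine ⟨Complex.exp (2 * Real.pi * Complex.I / 3), ?_, hprim.pow_eq_one⟩
    have hs := hprim.geom_sum_eq_zero (by norm_num)
    simpa [Finset.sum_range_succ, add_assoc] using hs
  obtain ⟨χ, hχ⟩ : ∃ χ : Fin 3 → Fin 3 → ℂ,
      χ = fun k s => ![![(1 : ℂ), 1, 1], ![1, ω, ω ^ 2], ![1, ω ^ 2, ω]] k s := ⟨_, rfl⟩
  have hmul : ∀ k s t : Fin 3, χ k s * χ k t = χ k (s + t) := by
    intro k s t
    fin_cases k <;> fin_cases s <;> fin_cases t <;> simp [hχ] <;>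
      first
      | ring1
      | linear_combination h3
      | linear_combination ω * h3
  have hδ : ∀ s : Fin 3, ∑ k, χ k s = if s = 0 then 3 else 0 := by
    intro s
    fin_cases s <;> simp [hχ, Fin.sum_univ_three] <;>
      first
      | ring1
      | linear_combination hω
  refine tensorRank_le_of_eq_sum (fun k x => (1 / 3 : ℂ) * f x * χ k x) (fun k y => g y * χ k y)
    (fun k z => h z * χ k z) ?_
  funext x y z
  rw [Finset.sum_apply, Finset.sum_apply, Finset.sum_apply]
  simp only [triad_apply]
  have hk : ∀ k : Fin 3, (1 / 3 : ℂ) * f x * χ k x * (g y * χ k y) * (h z * χ k z)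
      = (1 / 3 : ℂ) * (f x * g y * h z) * χ k (x + y + z) := by
    intro k
    rw [← hmul k (x + y) z, ← hmul k x y]
    ring
  rw [Finset.sum_congr rfl (fun k _ => hk k), ← Finset.mul_sum, hδ]
  split_ifs <;> ring

/-- First coordinate point: `u(a,0,0) = a·X₁ = Σ_i a·e_i ⊗ e_i ⊗ e_i` has rank ≤ 3. -/
theorem unitPoints_coord₁ (a : ℂ) :
    tensorRank (fun x y z : Fin 3 => if x + y + z = 0 then ![a, 0, 0] (y - x) else (0 : ℂ)) ≤ 3 := by
  have key : (fun x y z : Fin 3 => if x + y + z = 0 then ![a, 0, 0] (y - x) else (0 : ℂ))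
      = fun x y z : Fin 3 => if y = x ∧ z = x then a else 0 := by
    funext x y z
    fin_cases x <;> fin_cases y <;> fin_cases z <;> simp
  rw [key]
  exact unitPoints_tensorRank_pattern_le (fun _ => a) (fun x => x) (fun x => x)

/-- Second coordinate point: `u(0,b,0) = b·X₂ = Σ_i b·e_i ⊗ e_{i+1} ⊗ e_{i+2}` has rank ≤ 3. -/
theorem unitPoints_coord₂ (b : ℂ) :
    tensorRank (fun x y z : Fin 3 => if x + y + z = 0 then ![0, b, 0] (y - x) else (0 : ℂ)) ≤ 3 := by
  have key : (fun x y z : Fin 3 => if x + y + z = 0 then ![0, b, 0] (y - x) else (0 : ℂ))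
      = fun x y z : Fin 3 => if y = x + 1 ∧ z = x + 2 then b else 0 := by
    funext x y z
    fin_cases x <;> fin_cases y <;> fin_cases z <;> simp
  rw [key]
  exact unitPoints_tensorRank_pattern_le (fun _ => b) (fun x => x + 1) (fun x => x + 2)

/-- Third coordinate point: `u(0,0,c) = c·X₃ = Σ_i c·e_i ⊗ e_{i+2} ⊗ e_{i+1}` has rank ≤ 3. -/
theorem unitPoints_coord₃ (c : ℂ) :
    tensorRank (fun x y z : Fin 3 => if x + y + z = 0 then ![0, 0, c] (y - x) else (0 : ℂ)) ≤ 3 := by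
  have key : (fun x y z : Fin 3 => if x + y + z = 0 then ![0, 0, c] (y - x) else (0 : ℂ))
      = fun x y z : Fin 3 => if y = x + 2 ∧ z = x + 1 then c else 0 := by
    funext x y z
    fin_cases x <;> fin_cases y <;> fin_cases z <;> simp
  rw [key]
  exact unitPoints_tensorRank_pattern_le (fun _ => c) (fun x => x + 2) (fun x => x + 1)

/-- The nine torus points with `a ≠ 0`: if `a³ = b³ = c³` and `a ≠ 0` then `u(a,b,c)` is the
support tensor weighted by `f = (1,1,c²/(ab))`, `g = (a,ab/c,b)`, `h = (1,c/b,c/a)`, hence of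
rank ≤ 3. -/
theorem unitPoints_torus {a b c : ℂ} (ha : a ≠ 0) (hab : a ^ 3 = b ^ 3) (hbc : b ^ 3 = c ^ 3) :
    tensorRank (fun x y z : Fin 3 => if x + y + z = 0 then ![a, b, c] (y - x) else (0 : ℂ)) ≤ 3 := by
  have hb : b ≠ 0 := by
    rintro rfl
    exact ha ((pow_eq_zero_iff three_ne_zero).1 (hab.trans (by norm_num)))
  have hc : c ≠ 0 := by
    rintro rfl
    exact hb ((pow_eq_zero_iff three_ne_zero).1 (hbc.trans (by norm_num)))
  have key : (fun x y z : Fin 3 => if x + y + z = 0 then ![a, b, c] (y - x) else (0 : ℂ))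
      = fun x y z : Fin 3 => if x + y + z = 0 then
          ![(1 : ℂ), 1, c ^ 2 / (a * b)] x * ![a, a * b / c, b] y * ![(1 : ℂ), c / b, c / a] z
        else 0 := by
    funext x y z
    fin_cases x <;> fin_cases y <;> fin_cases z <;> simp <;> (try field_simp) <;>
      first
      | ring1
      | linear_combination hab + hbc
      | linear_combination -(hab + hbc)
      | linear_combination hbc
  rw [key]
  exact unitPoints_tensorRank_supportMul_le _ _ _

/-- **Item `stmt-MatrixMultiplication-4899` (`UnitPoints`).** At the three coordinate points and
the nine points `a³ = b³ = c³` of the Hessian plane, `R(u(a,b,c)) ≤ 3`. -/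
theorem unitPoints_proof :
    Summit.MatrixMultiplication.MatrixMultiplication.Theses.HessianPlane.UnitPoints := by
  unfold Summit.MatrixMultiplication.MatrixMultiplication.Theses.HessianPlane.UnitPoints
  intro a b c habc
  rcases habc with ⟨hb, hc⟩ | ⟨ha, hc⟩ | ⟨ha, hb⟩ | ⟨hab, hbc⟩
  · subst hb; subst hc
    exact unitPoints_coord₁ a
  · subst ha; subst hc
    exact unitPoints_coord₂ b
  · subst ha; subst hb
    exact unitPoints_coord₃ c
  · by_cases ha : a = 0
    · have hb : b = 0 := (pow_eq_zero_iff three_ne_zero).1 (hab.symm.trans (by rw [ha]; norm_num))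
      have hc : c = 0 := (pow_eq_zero_iff three_ne_zero).1 (hbc.symm.trans (by rw [hb]; norm_num))
      subst ha; subst hb; subst hc
      exact unitPoints_coord₁ 0
    · exact unitPoints_torus ha hab hbc

end Summit.MatrixMultiplication.MatrixMultiplication.Theorems
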